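import Literature.Probability.RandomPlanarGeometry.HexSAWLattice
import HarnessLib

/-!
# The strip domains of Duminil-Copin–Smirnov and their partition functions

Topic `Literature/Probability/RandomPlanarGeometry`; second support file for the discharge of
`Literature.Probability.RandomPlanarGeometry.SAW.DuminilCopinSmirnov2012_thm1` (`HexSAW.lean`). Source: H. Duminil-Copin, S. Smirnov,
*The connective constant of the honeycomb lattice equals `√(2+√2)`*, Ann. of Math. 175 (2012),
1653–1665 (arXiv:1007.0575), §1 ("It will be convenient to consider walks between mid-edges of
`ℍ` … We will write `γ : a → E` if a walk `γ` starts at `a` and ends at some mid-edge of `E` … The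
length `ℓ(γ)` of the walk is the number of vertices visited by `γ`") and §3 ("We consider a
vertical strip domain `S_T` composed of `T` strips of hexagons, and its finite version `S_{T,L}`
cut at heights `±L` at angles `±π/3` … Denote by `α` the left boundary of `S_T`, by `β` the
right one. Symbols `ε` and `ε̄` denote the top and bottom boundaries of `S_{T,L}`", the partition
functions `A_{T,L}^x`, `B_{T,L}^x`, `E_{T,L}^x`, and **Lemma 2**: "For critical `x = x_c`,
`1 = c_α A_{T,L}^{x_c} + B_{T,L}^{x_c} + c_ε E_{T,L}^{x_c}`, with `c_α = cos(3π/8)`,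
`c_ε = cos(π/4)`").

## Contents (namespace `Literature.Probability.RandomPlanarGeometry.SAW.HV`, coordinate model `HV` of `HexSAWLattice.lean`)

* `HV.lev v = 2 x₁ + b` — the level of a vertex (DCS's coordinate across the strip: every edge
  joins consecutive levels); `HV.wOut = w`, the outer endpoint of the starting mid-edge `a`, the
  midpoint of the edge `{w, O}` below the origin `O = hvOrigin`.
* `HV.stripV T L = V(S_{T,L})` — levels `0, …, 2T-1`, cut obliquely: `-L - x₁ - b ≤ x₀ ≤ L` (a
  trapezoid symmetric under the reflection of `ℍ` fixing `a`; our strip is drawn horizontally,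
  DCS's vertically).
* `HV.IsMidWalk V P` — self-avoiding walks from the mid-edge `a` to a mid-edge, inside the domain
  with vertex set `V`, as vertex lists `P = [w, O, v₁, …, v_{ℓ-1}, u]` (`u` = far endpoint of the
  final mid-edge); `HV.midWalks V` (their finset), `HV.mwLen = ℓ`, `HV.finalDart`, `HV.inner`.
* `HV.IsAlphaDart`, `HV.IsBetaDart T`, `HV.IsEpsDart L` — the final half-edge lies on `α ∖ {a}`,
  `β`, `ε ∪ ε̄`; `HV.stripA`, `HV.stripB`, `HV.stripE` — `A_{T,L}^x`, `B_{T,L}^x`, `E_{T,L}^x`.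
* NAMED FACT `Literature.Probability.RandomPlanarGeometry.SAW.DuminilCopinSmirnov2012_lemma2` (Lemma 2) as a `def : Prop`.

## Design

Walks between mid-edges are vertex lists including the two outer endpoints `w` (before `O`) and
`u` (after the last visited vertex); "no edge used twice" becomes `u ≠` the vertex before the last
(so the only walk `a → a` is the trivial `[w, O]`), and `u` may be a previously visited vertex
(the walks pairing up in DCS's proof of Lemma 1). All sets are explicit finsets, all partition
functions finite sums of `x ^ ℓ`.
-/

noncomputable section

open Finset Literature.Probability.LatticeModels Literature.Probability.Percolation

namespace Literature.Probability.RandomPlanarGeometry.SAW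

namespace HV

/-! ### Coordinates: level and type -/

/-- The type bit of a vertex as an integer (`0` for up triangles, `1` for down triangles).
[folklore] -/
def bit (v : HV) : ℤ := if v.2.2 then 1 else 0

/-- The **level** `h(x₀, x₁, b) = 2 x₁ + b` of a vertex: DCS's "real part" in lattice units
(every edge of `ℍ` joins consecutive levels; vertices of type `0` sit at even levels and have one
edge down and two edges up). [cite: DuminilCopinSmirnov2012, §3 (Fig. 3)] -/
def lev (v : HV) : ℤ := 2 * v.2.1 + bit v

/-- Up triangles have bit `0`. [folklore] -/
@[simp] theorem bit_false (a b : ℤ) : bit (a, b, false) = 0 := rfl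
/-- Down triangles have bit `1`. [folklore] -/
@[simp] theorem bit_true (a b : ℤ) : bit (a, b, true) = 1 := rfl
/-- The level in coordinates. [cite: DuminilCopinSmirnov2012, §3] -/
@[simp] theorem lev_mk (a b : ℤ) (c : Bool) : lev (a, b, c) = 2 * b + bit (a, b, c) := rfl

/-- Along an edge the level changes by `±1`. [cite: DuminilCopinSmirnov2012, §3] -/
theorem lev_eq_of_adj {u v : HV} (h : hvGraph.Adj u v) : lev v = lev u + 1 ∨ lev v = lev u - 1 := by
  obtain ⟨a, b, c⟩ := u
  obtain ⟨a', b', c'⟩ := v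
  cases c <;> cases c' <;> simp [hvGraph_adj, AdjRel] at h ⊢ <;> omega

/-- The outer endpoint `w` of the starting mid-edge `a`: `a` is the midpoint of the vertical edge
`{w, O}` below the origin `O = (0, 0, false)`. [cite: DuminilCopinSmirnov2012, §3] -/
def wOut : HV := (0, -1, true)

/-- The origin is on level `0`. [cite: DuminilCopinSmirnov2012, §3] -/
@[simp] theorem lev_hvOrigin : lev hvOrigin = 0 := rfl
/-- The outer endpoint of `a` is on level `-1`. [cite: DuminilCopinSmirnov2012, §3] -/
@[simp] theorem lev_wOut : lev wOut = -1 := rfl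

/-- `a` is an edge of `ℍ`: `w ∼ O`. [cite: DuminilCopinSmirnov2012, §3] -/
theorem adj_wOut_hvOrigin : hvGraph.Adj wOut hvOrigin := by decide

/-! ### The trapezoidal strip domains `S_{T,L}` -/

/-- The vertex set `V(S_{T,L})` of the finite strip domain: levels `0 ≤ h ≤ 2T - 1` ("`T` strips
of hexagons" to the right of `a`), cut by the two lines at angles `±π/3` through hexagon centres
at distance `L` from `a`: in coordinates `-L - x₁ - b ≤ x₀ ≤ L`. The domain is symmetric under
the reflection fixing `a`, its boundary mid-edges are `α` (level `0`, pointing down), `β`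
(level `2T-1`, pointing up), `ε`, `ε̄` (the two cuts). [cite: DuminilCopinSmirnov2012, §3 (S_{T,L}, Fig. 3)] -/
def stripV (T L : ℕ) : Finset HV :=
  ((Icc (-(L : ℤ) - T) L) ×ˢ (Icc (0 : ℤ) T) ×ˢ (univ : Finset Bool)).filter fun v =>
    lev v ≤ 2 * T - 1 ∧ -(L : ℤ) - v.2.1 - bit v ≤ v.1

/-- Membership in `V(S_{T,L})`. [cite: DuminilCopinSmirnov2012, §3] -/
theorem mem_stripV_iff {T L : ℕ} {v : HV} :
    v ∈ stripV T L ↔ 0 ≤ v.2.1 ∧ lev v ≤ 2 * T - 1 ∧ -(L : ℤ) - v.2.1 - bit v ≤ v.1 ∧ v.1 ≤ L := by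
  obtain ⟨a, b, c⟩ := v
  simp only [stripV, mem_filter, mem_product, mem_Icc, mem_univ, and_true, lev_mk]
  cases c <;> simp <;> omega

/-- The origin lies in every strip domain with `T ≥ 1`. [cite: DuminilCopinSmirnov2012, §3] -/
theorem hvOrigin_mem_stripV {T L : ℕ} (hT : 1 ≤ T) : hvOrigin ∈ stripV T L := by
  rw [mem_stripV_iff]; simp [hvOrigin]; omega

/-- The outer vertex `w` of `a` is outside every strip domain. [cite: DuminilCopinSmirnov2012, §3] -/
theorem wOut_not_mem_stripV (T L : ℕ) : wOut ∉ stripV T L := by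
  rw [mem_stripV_iff]; simp [wOut]

/-- The strip domains increase with `L`. [cite: DuminilCopinSmirnov2012, §3] -/
theorem stripV_mono_L {T L L' : ℕ} (h : L ≤ L') : stripV T L ⊆ stripV T L' := by
  intro v hv
  rw [mem_stripV_iff] at hv ⊢
  omega

/-- The strip domains increase with `T`. [cite: DuminilCopinSmirnov2012, §3] -/
theorem stripV_mono_T {T T' L : ℕ} (h : T ≤ T') : stripV T L ⊆ stripV T' L := by
  intro v hv
  rw [mem_stripV_iff] at hv ⊢
  omega

/-! ### Self-avoiding walks between mid-edges, from `a` -/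

/-- The inner (visited) vertices `v₀, …, v_{ℓ-1}` of a mid-edge walk list
`[w, v₀, …, v_{ℓ-1}, u]`. [cite: DuminilCopinSmirnov2012, §1] -/
def inner (P : List HV) : List HV := P.tail.dropLast

/-- **Self-avoiding walk from the mid-edge `a` to a mid-edge, inside the domain with vertex set
`V`** ("`γ ⊂ Ω : a → z`"), encoded as the vertex list `[w, v₀ = O, v₁, …, v_{ℓ-1}, u]`: it enters
`v₀` through `a` (from `w`), visits the `ℓ ≥ 0` distinct vertices `v₀, …, v_{ℓ-1}` of `V`, and
ends at the midpoint of the edge `{v_{ℓ-1}, u}` (`u` arbitrary: inside, outside, or an earlier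
vertex), the final half-edge not retracing the previous one (`u ≠ v_{ℓ-2}`, resp. `u ≠ w` when
`ℓ = 1`: "the only walk from `a` to `a` is the trivial one", `ℓ = 0`, the list `[w, O]`); the
last condition is stated as "the third-to-last entry differs from the last" via `getLast?`
(vacuous for the trivial walk).
[cite: DuminilCopinSmirnov2012, §1–§2] -/
def IsMidWalk (V : Finset HV) (P : List HV) : Prop :=
  P.IsChain hvGraph.Adj ∧ P.head? = some wOut ∧ P.tail.head? = some hvOrigin ∧
    (∀ x ∈ inner P, x ∈ V) ∧ (inner P).Nodup ∧ P.dropLast.dropLast.getLast? ≠ P.getLast?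

/-- Being a mid-edge walk is decidable. [folklore] -/
instance (V : Finset HV) : DecidablePred (IsMidWalk V) := fun P => by
  unfold IsMidWalk; infer_instance

/-- `ℓ(γ)`, the number of vertices visited. [cite: DuminilCopinSmirnov2012, §1] -/
def mwLen (P : List HV) : ℕ := P.length - 2

/-- The final half-edge of a mid-edge walk, as the dart `(v_{ℓ-1}, u)` (for the trivial walk:
`(w, O)`). [cite: DuminilCopinSmirnov2012, §1] -/
def finalDart (P : List HV) : HV × HV := (P.dropLast.getLast?.getD wOut, P.getLast?.getD wOut)

/-- Candidate vertices for the entries of a mid-edge walk in `V`. [folklore] -/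
def mwSupport (V : Finset HV) : Finset HV :=
  insert wOut (insert hvOrigin (V ∪ V.biUnion fun v => (nbrs v).toFinset))

/-- The finset of all self-avoiding mid-edge walks from `a` in the domain `V` (finite: at most
`|V|` inner vertices). [cite: DuminilCopinSmirnov2012, §2] -/
def midWalks (V : Finset HV) : Finset (List HV) :=
  ((range (V.card + 3)).biUnion fun n => listsLen (mwSupport V) n).filter (IsMidWalk V)


/-! ### Basic anatomy of mid-edge walks -/

section Anatomy

variable {V : Finset HV} {P : List HV}

/-- A mid-edge walk list is `w :: O :: _`. [cite: DuminilCopinSmirnov2012, §1] -/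
theorem IsMidWalk.exists_eq_cons (h : IsMidWalk V P) :
    ∃ Q : List HV, P = wOut :: hvOrigin :: Q := by
  obtain ⟨-, h1, h2, -⟩ := h
  match P, h1, h2 with
  | a :: b :: Q, h1, h2 =>
    simp only [List.head?_cons, Option.some.injEq, List.tail_cons] at h1 h2
    subst h1; subst h2; exact ⟨Q, rfl⟩

/-- A mid-edge walk list has length at least `2`. [cite: DuminilCopinSmirnov2012, §1] -/
theorem IsMidWalk.two_le_length (h : IsMidWalk V P) : 2 ≤ P.length := by
  obtain ⟨Q, rfl⟩ := h.exists_eq_cons; simp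

/-- `inner (w :: Q) = Q.dropLast`. [folklore] -/
@[simp] theorem inner_cons (a : HV) (Q : List HV) : inner (a :: Q) = Q.dropLast := rfl

/-- The length of a mid-edge walk list is `ℓ + 2`. [cite: DuminilCopinSmirnov2012, §1] -/
theorem IsMidWalk.length_eq (h : IsMidWalk V P) : P.length = mwLen P + 2 := by
  have := h.two_le_length; unfold mwLen; omega

/-- `ℓ` is the number of inner vertices. [cite: DuminilCopinSmirnov2012, §1] -/
theorem IsMidWalk.length_inner (h : IsMidWalk V P) : (inner P).length = mwLen P := by
  obtain ⟨Q, rfl⟩ := h.exists_eq_cons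
  simp [inner, mwLen, List.length_dropLast]

/-- The inner vertices are at most `|V|` in number. [cite: DuminilCopinSmirnov2012, §2] -/
theorem IsMidWalk.mwLen_le_card (h : IsMidWalk V P) : mwLen P ≤ V.card := by
  rw [← h.length_inner, ← List.toFinset_card_of_nodup h.2.2.2.2.1]
  exact card_le_card fun x hx => h.2.2.2.1 x (List.mem_toFinset.1 hx)

/-- Every entry of a mid-edge walk in `V` is `w`, `O`, a vertex of `V` or a neighbour of one.
[folklore] -/
theorem IsMidWalk.mem_mwSupport (h : IsMidWalk V P) : ∀ x ∈ P, x ∈ mwSupport V := by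
  obtain ⟨Q, rfl⟩ := h.exists_eq_cons
  obtain ⟨hc, -, -, hV, -, -⟩ := h
  intro x hx
  simp only [mwSupport, mem_insert, mem_union, mem_biUnion, List.mem_toFinset]
  rcases List.mem_cons.1 hx with rfl | hx
  · exact Or.inl rfl
  rcases List.mem_cons.1 hx with rfl | hx
  · exact Or.inr (Or.inl rfl)
  -- x ∈ Q: either in dropLast (hvOrigin :: Q) or the last element
  have hsplit := List.dropLast_append_getLast (List.cons_ne_nil hvOrigin Q)
  simp only [inner_cons] at hV
  by_cases hxin : x ∈ (hvOrigin :: Q).dropLast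
  · exact Or.inr (Or.inr (Or.inl (hV x hxin)))
  · -- x is the last element of `O :: Q`, adjacent to the last inner vertex
    have hxlast : x = (hvOrigin :: Q).getLast (List.cons_ne_nil _ _) := by
      have : x ∈ (hvOrigin :: Q).dropLast ++ [(hvOrigin :: Q).getLast (List.cons_ne_nil _ _)] := by
        rw [hsplit]; exact List.mem_cons_of_mem _ hx
      simpa [hxin] using this
    have hQ : Q ≠ [] := by rintro rfl; simp at hx
    have hne : (hvOrigin :: Q).dropLast ≠ [] := by
      cases Q with
      | nil => exact absurd rfl hQ
      | cons b Q => simp [List.dropLast_cons_of_ne_nil, List.cons_ne_nil]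
    -- adjacency of the last inner vertex with x
    have hc' : (wOut :: ((hvOrigin :: Q).dropLast ++ [x])).IsChain hvGraph.Adj := by
      rw [hxlast, hsplit]; exact hc
    have hadj : hvGraph.Adj ((hvOrigin :: Q).dropLast.getLast hne) x := by
      have := (List.isChain_cons.1 hc').2
      rw [List.isChain_append] at this
      obtain ⟨-, -, h3⟩ := this
      exact h3 _ (List.getLast?_eq_some_getLast hne ▸ rfl) x rfl
    refine Or.inr (Or.inr (Or.inr ⟨_, hV _ (List.getLast_mem hne), ?_⟩))
    exact (hvGraph_adj_iff_mem_nbrs _ _).1 hadj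

/-- `midWalks V` is exactly the set of self-avoiding mid-edge walks from `a` in `V`.
[cite: DuminilCopinSmirnov2012, §2] -/
theorem mem_midWalks_iff {V : Finset HV} {P : List HV} : P ∈ midWalks V ↔ IsMidWalk V P := by
  rw [midWalks, mem_filter, mem_biUnion]
  constructor
  · exact fun h => h.2
  · intro h
    refine ⟨⟨P.length, ?_, ?_⟩, h⟩
    · rw [mem_range, h.length_eq]; have := h.mwLen_le_card; omega
    · exact mem_listsLen_iff.2 ⟨rfl, h.mem_mwSupport⟩

/-- Mid-edge walks are monotone in the domain. [cite: DuminilCopinSmirnov2012, §3] -/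
theorem IsMidWalk.mono {V W : Finset HV} (hVW : V ⊆ W) (h : IsMidWalk V P) : IsMidWalk W P :=
  ⟨h.1, h.2.1, h.2.2.1, fun x hx => hVW (h.2.2.2.1 x hx), h.2.2.2.2.1, h.2.2.2.2.2⟩

/-- The trivial walk `[w, O]` from `a` to `a`. [cite: DuminilCopinSmirnov2012, §3 ("F(a) = 1")] -/
theorem isMidWalk_trivial (V : Finset HV) : IsMidWalk V [wOut, hvOrigin] := by
  refine ⟨?_, rfl, rfl, by simp [inner], by simp [inner], by simp⟩
  simpa using adj_wOut_hvOrigin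

end Anatomy

/-! ### Boundary classes and the partition functions `A_{T,L}`, `B_{T,L}`, `E_{T,L}` -/

/-- The final half-edge lies on `α ∖ {a}`... precisely: the dart goes from a level-`0` vertex
straight down (out of every `S_{T,L}`); the reversed dart of `a` never occurs as a final dart of a
self-avoiding walk of positive length. [cite: DuminilCopinSmirnov2012, §3 (α)] -/
def IsAlphaDart (d : HV × HV) : Prop :=
  d.1.2.1 = 0 ∧ d.1.2.2 = false ∧ d.2 = (d.1.1, -1, true)

/-- The final half-edge lies on `β`: from the top level `2T - 1` of `S_T` straight up.
[cite: DuminilCopinSmirnov2012, §3 (β)] -/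
def IsBetaDart (T : ℕ) (d : HV × HV) : Prop :=
  d.1.2.1 = (T : ℤ) - 1 ∧ d.1.2.2 = true ∧ d.2 = (d.1.1, d.1.2.1 + 1, false)

/-- The final half-edge lies on `ε ∪ ε̄`: it crosses one of the two oblique cuts of `S_{T,L}`.
[cite: DuminilCopinSmirnov2012, §3 (ε, ε̄)] -/
def IsEpsDart (L : ℕ) (d : HV × HV) : Prop :=
  d.1.2.2 = true ∧ ((d.1.1 = -(L : ℤ) - d.1.2.1 - 1 ∧ d.2 = (d.1.1, d.1.2.1, false)) ∨
    (d.1.1 = L ∧ d.2 = (d.1.1 + 1, d.1.2.1, false)))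

/-- Decidability of the `α` class. [folklore] -/
instance : DecidablePred IsAlphaDart := fun d => by unfold IsAlphaDart; infer_instance
/-- Decidability of the `β` class. [folklore] -/
instance (T : ℕ) : DecidablePred (IsBetaDart T) := fun d => by unfold IsBetaDart; infer_instance
/-- Decidability of the `ε ∪ ε̄` class. [folklore] -/
instance (L : ℕ) : DecidablePred (IsEpsDart L) := fun d => by unfold IsEpsDart; infer_instance

/-- `A_{T,L}(x) = Σ_{γ ⊂ S_{T,L} : a → α∖{a}} x^{ℓ(γ)}`. [cite: DuminilCopinSmirnov2012, §3] -/
def stripA (T L : ℕ) (x : ℝ) : ℝ :=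
  ∑ P ∈ (midWalks (stripV T L)).filter (fun P => IsAlphaDart (finalDart P)), x ^ mwLen P

/-- `B_{T,L}(x) = Σ_{γ ⊂ S_{T,L} : a → β} x^{ℓ(γ)}`. [cite: DuminilCopinSmirnov2012, §3] -/
def stripB (T L : ℕ) (x : ℝ) : ℝ :=
  ∑ P ∈ (midWalks (stripV T L)).filter (fun P => IsBetaDart T (finalDart P)), x ^ mwLen P

/-- `E_{T,L}(x) = Σ_{γ ⊂ S_{T,L} : a → ε ∪ ε̄} x^{ℓ(γ)}`. [cite: DuminilCopinSmirnov2012, §3] -/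
def stripE (T L : ℕ) (x : ℝ) : ℝ :=
  ∑ P ∈ (midWalks (stripV T L)).filter (fun P => IsEpsDart L (finalDart P)), x ^ mwLen P

end HV

open HV in
/-- NAMED FACT — **Duminil-Copin–Smirnov 2012, Lemma 2** (eq. (3)): "For critical `x = x_c`, the
following identity holds: `1 = c_α A^{x_c}_{T,L} + B^{x_c}_{T,L} + c_ε E^{x_c}_{T,L}`, with positive
coefficients `c_α = cos(3π/8)` and `c_ε = cos(π/4)`", for the strip domain `S_{T,L}` of `T ≥ 1`
strips of hexagons cut at height `L` (`HV.stripV`), `x_c = 1/√(2+√2)` (`hexCriticalFugacity`) and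
the partition functions `HV.stripA`, `HV.stripB`, `HV.stripE` of self-avoiding walks from the
mid-edge `a` to the three parts `α ∖ {a}`, `β`, `ε ∪ ε̄` of the boundary. (Proof in print: sum the
vertex relation of Lemma 1 for the parafermionic observable over `V(S_{T,L})`; the boundary
windings are `±π`, `0`, `±2π/3`.) [cite: DuminilCopinSmirnov2012, Lemma 2] -/
def DuminilCopinSmirnov2012_lemma2 : Prop :=
  ∀ T L : ℕ, 1 ≤ T →
    1 = Real.cos (3 * Real.pi / 8) * stripA T L hexCriticalFugacity +
      stripB T L hexCriticalFugacity + Real.cos (Real.pi / 4) * stripE T L hexCriticalFugacity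

end Literature.Probability.RandomPlanarGeometry.SAW
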